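import Summits.QuantumFields.YangMills.Theorems.LuscherReductionTwistedTraceScalingVacuumFloor
import HarnessLib

/-!
# `stub_valleyGain` of crux `FixedLatticeLaw` (stmt-QuantumFields-23943 ≡ leaf `FemtoGapFixedLattice`, route `FemtoCutoffLadder`, line «rate»)
# ⟸ route RED's k = 0 FLOOR: `ValleyGainAt L (β^{−p}) (β^{−q})` from `ValleyFloorAt L (β^{−p}) (1/2) N_B` / from `VacuumFloorAt` + normalisation comparison

Lead seat `ym-line-fcl-p1` g4 (2026-08-28).  The registered «rate» skeleton of crux 23943 has the stub
`stub_valleyGain : ∀ L, ValleyGainAt L (powScale (1/40)) (powScale (17/20))` — VERBATIM route RED's open C3 text at RED's exponent ledger.  Route RED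
(`LuscherReduction`, lane A of S-BASE, `pub/ym-fleet/ym-luscher-20007-p1/COARSE-DESIGN.md` §16–§18) has landed the whole VALLEY chain except the k = 0 floor:
GEOMETRY (`valleyGeomAt_pow`, `0 < p`, `4p < q`), the UPPER super-solution clause with lane B's normalisation `N_B` (`valleyBOUpperAt_pow`, `0 < q`, `0 < r`,
`2r < 1`, `0 < m`, `2r < q − m/2`), the weak-currency skeleton (`valleyKernelRowBoundAt_of_boWeak_geom`, needs `λ_b(L³β) = o(β^{−p})`, i.e. `p < 1/3`) and the
Schur door (`valleyGainAt_of_kernelRowBound`); RED's own end-to-end theorems (`coarseNoIntruderAt_of_floor_pow`, `…_of_vacuumFloor_pow`) go straight to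
COARSE-UPPER(L) and keep `ValleyGainAt` implicit.  This file EXPOSES the intermediate for route FCL:
* `valleyBOWeakAt_of_floor_pow` — FLOOR(N_B) + RED's unconditional UPPER(N_B) ⇒ `ValleyBOWeakAt L (β^{−p}) (β^{−q})` (RED's inline recombination, named);
* ★ `valleyGainAt_of_floor_pow` — `0 < p < 1/3`, `4p < q`, `0 < r`, `2r < 1`, `0 < m`, `2r < q − m/2`:
  `ValleyFloorAt L (powScale p) (1/2) N_B → ValleyGainAt L (powScale p) (powScale q)`;
* ★ `valleyGainAt_of_vacuumFloor_pow` — the same from RED's typed hand-over `VacuumFloorAt L Λ tol` + `tol = o(β^{−p})` + the normalisation comparison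
  `N_B e^{−6·toronZPE (1/2) 0 0} ≤ Λ e^{o(β^{−p})}` (`valleyFloorAt_of_vacuumFloor`);
* ★★ `valleyGainAll_of_floor` / `valleyGainAll_of_vacuumFloor` — the `∀ L` forms at RED's ledger `(p, q, r, m) = (1/40, 17/20, 41/100, 11/200)`: their
  conclusion is LITERALLY the body of `stub_valleyGain` (`∀ L [NeZero L], ValleyGainAt L (powScale (1/40)) (powScale (17/20))`), so the stub closes by `exact`
  the moment RED lands its floor (F6 `…FloorAssembly` / F7 `…FloorNormalisation` of lane A g10) for every `L`.
HONEST FRAMING: bookkeeping (a named intermediate of RED's kernel-checked chain); the k = 0 FLOOR itself is RED lane A's build in progress and is NOT proved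
here; femto rung R2b1 (RECORD label) — not infinite volume, not a mass gap, not Clay.  No definitions, no named facts, no `sorry`.
-/

set_option autoImplicit false

noncomputable section

open MeasureTheory Filter Topology Real
open scoped BigOperators
open Literature.MathematicalPhysics.QuantumFieldTheory hiding SU2
open Literature.MathematicalPhysics.QuantumLattice

namespace Summit.QuantumFields.YangMills.Theorems.FemtoCutoffLadder

open Summit.QuantumFields.YangMills.Theorems.FemtoTransferGap
open TwoLattice TwoLattice.Toron TwoLattice.Cov TwoLattice.Stiff

variable {L : ℕ} [NeZero L]

/-! ## §1 FLOOR(N_B) ⇒ weak BO ⇒ VALLEY GAIN, at polynomial scales -/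

/-- **FLOOR(N_B) + RED's unconditional UPPER(N_B) ⇒ the weak BO sub-target** at `(β^{−p}, β^{−q})` with `κ = 1/2`: for `0 < q`, `0 < r`, `2r < 1`, `0 < m`,
`2r < q − m/2`, `ValleyFloorAt L (powScale p) (1/2) N_B → ValleyBOWeakAt L (powScale p) (powScale q)`, `N_B β = riccatiN L β (β^{−r}) (2β^{−q}) (β^{−m})`
(positive for `β > 0`; both clauses are eventual, so `β ≥ 1` is imposed inside).  RED's recombination inside `coarseNoIntruderAt_of_floor_pow`, named.
[cite: Luscher1983, §3] [cite: Wipf2021, §8.5.2] -/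
theorem valleyBOWeakAt_of_floor_pow {p q r m : ℝ} (hq : 0 < q) (hr : 0 < r) (hr1 : 2 * r < 1) (hm : 0 < m) (hrq : 2 * r < q - m / 2)
    (hF : ValleyFloorAt L (powScale p) (1 / 2) (fun β => riccatiN L β (powScale r β) (2 * powScale q β) (powScale m β))) :
    ValleyBOWeakAt L (powScale p) (powScale q) := by
  have hU := valleyBOUpperAt_pow (L := L) (p := p) hq hr hr1 hm hrq
  refine ⟨1 / 2, by norm_num, fun ε hε => ?_⟩
  obtain ⟨βU, hβU⟩ := hU ε hε
  obtain ⟨βF, hβF⟩ := hF ε hε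
  refine ⟨max 1 (max βU βF), fun β hβ => ?_⟩
  have hβ1 : 1 ≤ β := (le_max_left _ _).trans hβ
  have hβ0 : 0 < β := by linarith
  refine ⟨riccatiN L β (powScale r β) (2 * powScale q β) (powScale m β), riccatiN_pos hβ0 _ _ _,
    hβF β ((le_max_right _ _).trans ((le_max_right _ _).trans hβ)), ?_⟩
  obtain ⟨h, c, Ch, hhm, hc, hh0, hhC, hhc, hrow⟩ := hβU β ((le_max_left _ _).trans ((le_max_right _ _).trans hβ))
  exact ⟨h, c, Ch, hhm, hc, hh0, hhC, hhc, hrow⟩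

/-- ★ **VALLEY GAIN from the k = 0 FLOOR** at polynomial scales: for `0 < p < 1/3`, `4p < q`, `0 < r`, `2r < 1`, `0 < m`, `2r < q − m/2`,
`ValleyFloorAt L (powScale p) (1/2) N_B → ValleyGainAt L (powScale p) (powScale q)` — FLOOR ⇒ weak BO (above), GEOMETRY is RED's `valleyGeomAt_pow`,
`λ_b(L³β) = o(β^{−p})` is RED's `powScale_dominates_bareLambda`, then RED's weak-currency skeleton `valleyKernelRowBoundAt_of_boWeak_geom` and Schur door
`valleyGainAt_of_kernelRowBound`. [cite: Luscher1983, §3] [cite: LuscherMunster1984, §2] [cite: Grafakos2009, App. A.2] -/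
theorem valleyGainAt_of_floor_pow {p q r m : ℝ} (hp0 : 0 < p) (hp : p < 1 / 3) (hpq : 4 * p < q) (hr : 0 < r) (hr1 : 2 * r < 1) (hm : 0 < m)
    (hrq : 2 * r < q - m / 2)
    (hF : ValleyFloorAt L (powScale p) (1 / 2) (fun β => riccatiN L β (powScale r β) (2 * powScale q β) (powScale m β))) :
    ValleyGainAt L (powScale p) (powScale q) := by
  have hq0 : 0 < q := by linarith
  exact valleyGainAt_of_kernelRowBound
    (valleyKernelRowBoundAt_of_boWeak_geom (valleyBOWeakAt_of_floor_pow hq0 hr hr1 hm hrq hF) (valleyGeomAt_pow hp0 hpq)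
      (fun β => powScale_pos p β) (powScale_dominates_bareLambda hp))

/-- ★ **VALLEY GAIN from RED's typed vacuum floor + normalisation comparison**: for the same exponents, `VacuumFloorAt L Λ tol` with `Λ ≥ 0`,
`tol = o(β^{−p})` (`∀ ε > 0`, eventually `tol β ≤ ε·β^{−p}`) and, for every `ε > 0`, eventually `N_B(β)·e^{−6·toronZPE (1/2) 0 0} ≤ Λ(β)·e^{ε·β^{−p}}`, give
`ValleyGainAt L (powScale p) (powScale q)` (RED's `valleyFloorAt_of_vacuumFloor`, then `valleyGainAt_of_floor_pow`). [cite: Luscher1983, §3] [cite: LuscherMunster1984, §2] -/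
theorem valleyGainAt_of_vacuumFloor_pow {p q r m : ℝ} (hp0 : 0 < p) (hp : p < 1 / 3) (hpq : 4 * p < q) (hr : 0 < r) (hr1 : 2 * r < 1) (hm : 0 < m)
    (hrq : 2 * r < q - m / 2) {Λ tol : ℝ → ℝ} (hV : VacuumFloorAt L Λ tol) (hΛ : ∀ β, 0 ≤ Λ β)
    (htol : ∀ ε : ℝ, 0 < ε → ∃ β0 : ℝ, ∀ β : ℝ, β0 ≤ β → tol β ≤ ε * powScale p β)
    (hcmp : ∀ ε : ℝ, 0 < ε → ∃ β0 : ℝ, ∀ β : ℝ, β0 ≤ β →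
      riccatiN L β (powScale r β) (2 * powScale q β) (powScale m β) * Real.exp (-(6 * toronZPE L (1 / 2) 0 0)) ≤ Λ β * Real.exp (ε * powScale p β)) :
    ValleyGainAt L (powScale p) (powScale q) :=
  valleyGainAt_of_floor_pow hp0 hp hpq hr hr1 hm hrq (valleyFloorAt_of_vacuumFloor hV hΛ htol hcmp)

/-! ## §2 The `∀ L` forms at RED's exponent ledger `(p, q, r, m) = (1/40, 17/20, 41/100, 11/200)` — the body of `stub_valleyGain` -/

/-- ★★ **`stub_valleyGain` ⟸ RED's FLOOR(N_B) on every lattice**: if for every `L` the k = 0 floor `ValleyFloorAt L (powScale (1/40)) (1/2) N_B` holds at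
RED's ledger `(r, m) = (41/100, 11/200)`, then `∀ L, ValleyGainAt L (powScale (1/40)) (powScale (17/20))` — literally the registered stub's statement
(`1/40 < 1/3`, `4/40 < 17/20`, `82/100 < 1`, `82/100 < 17/20 − 11/400`). [cite: Luscher1983, §3] [cite: LuscherMunster1984, §2] -/
theorem valleyGainAll_of_floor
    (hF : ∀ (L : ℕ) [NeZero L], ValleyFloorAt L (powScale (1 / 40)) (1 / 2)
      (fun β => riccatiN L β (powScale (41 / 100) β) (2 * powScale (17 / 20) β) (powScale (11 / 200) β))) :
    ∀ (L : ℕ) [NeZero L], ValleyGainAt L (powScale (1 / 40)) (powScale (17 / 20)) := by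
  intro L _
  exact valleyGainAt_of_floor_pow (by norm_num) (by norm_num) (by norm_num) (by norm_num) (by norm_num) (by norm_num) (by norm_num) (hF L)

/-- ★★ **`stub_valleyGain` ⟸ RED's typed vacuum floor on every lattice**: if for every `L` there are `Λ_L ≥ 0`, `tol_L` with `VacuumFloorAt L Λ_L tol_L`,
`tol_L = o(β^{−1/40})` and the normalisation comparison `N_B e^{−6·toronZPE (1/2) 0 0} ≤ Λ_L e^{o(β^{−1/40})}` at `(r, m) = (41/100, 11/200)`, then
`∀ L, ValleyGainAt L (powScale (1/40)) (powScale (17/20))`. [cite: Luscher1983, §3] [cite: LuscherMunster1984, §2] -/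
theorem valleyGainAll_of_vacuumFloor
    (hV : ∀ (L : ℕ) [NeZero L], ∃ Λ tol : ℝ → ℝ, VacuumFloorAt L Λ tol ∧ (∀ β, 0 ≤ Λ β) ∧
      (∀ ε : ℝ, 0 < ε → ∃ β0 : ℝ, ∀ β : ℝ, β0 ≤ β → tol β ≤ ε * powScale (1 / 40) β) ∧
      (∀ ε : ℝ, 0 < ε → ∃ β0 : ℝ, ∀ β : ℝ, β0 ≤ β →
        riccatiN L β (powScale (41 / 100) β) (2 * powScale (17 / 20) β) (powScale (11 / 200) β) * Real.exp (-(6 * toronZPE L (1 / 2) 0 0)) ≤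
          Λ β * Real.exp (ε * powScale (1 / 40) β))) :
    ∀ (L : ℕ) [NeZero L], ValleyGainAt L (powScale (1 / 40)) (powScale (17 / 20)) := by
  intro L _
  obtain ⟨Λ, tol, hVL, hΛ, htol, hcmp⟩ := hV L
  exact valleyGainAt_of_vacuumFloor_pow (by norm_num) (by norm_num) (by norm_num) (by norm_num) (by norm_num) (by norm_num) (by norm_num)
    hVL hΛ htol hcmp

end Summit.QuantumFields.YangMills.Theorems.FemtoCutoffLadder

end
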